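import Summits.KontsevichZagierPeriods.KontsevichZagierPeriods.Theorems.DilationMove.Negative.LoadBearing

/-!
# `DilationMove` (stmt-KontsevichZagierPeriods-3872) — negative side II: tightness in all dimensions

Refuter (`cdisprove`, cycle 2) by-products for the crux `DilationMove` of route `HurwitzMicroSectors`.
The crux (dilation `x ↦ (xᵢ^m)ᵢ` of the open unit box `(0,1)ⁿ` as ONE change-of-variables move with
Jacobian factor `mⁿ·∏ᵢ xᵢ^(m-1)`) is TRUE; this file records that its Jacobian factor is FORCED in
every dimension `n ≥ 1`, with a DIMENSION-DEPENDENT constant — the slip to avoid when the consumers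
(`ReductionTwoSix`: `(n,m) = (2,2), (2,3)`; `AperySectorThreeTwo`: `(3,2)`) specialise `n`.

* kit: product-monomial reps `prodRep n c k = [(0,1)ⁿ, c·∏ᵢ xᵢ^k]` and their values `c/(k+1)ⁿ`
  (`value_prodRep`, Fubini on the box via `Measure.restrict_pi_pi` + `integral_fintype_prod_eq_pow`).
* `dilationMoveJac_necessary`: for `n ≥ 1` and EVERY `m : ℕ`, if the move on `(0,1)ⁿ` with factor
  `c·∏ᵢ xᵢ^k` (`c ∈ ℚ`, family `DilationMoveJac` of `LoadBearing`) is valid then `c = mⁿ` and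
  `k + 1 = m` (tests `r' = 1` and `r' = ∏ xᵢ`, then injectivity of `t ↦ tⁿ` on `(0,∞)`); with the
  crux this is an iff (`dilationMoveJac_iff_of`).
* corollaries: `not_dilationMoveJac_zero_exp` (`m = 0` is dead in every dimension for every factor —
  sharpens `dilationMove_false_without_oneLe`), `not_dilationMoveJac_two_two_linear` (`2·xy` is NOT a
  move at `(n,m) = (2,2)`: the `4` in `H_r + H_(r+3) ∼ 4·H_(2r+1)` is `2²`),
  `not_dilationMoveJac_noConstant` (`∏ xᵢ^(m-1)` without constant fails for `m ≥ 2`), and the junk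
  dimension `n = 0` (`dilationMoveJac_zero_necessary` / `_iff_of`: valid iff `c = 1`, any `m, k`).
[Kontsevich–Zagier 2001, §1.2, rule (2)]
-/

noncomputable section

open MeasureTheory Set MvPolynomial intervalIntegral
open Literature.NumberTheory.Transcendental Literature.ModelTheory.ExponentialFields

namespace Summit.KontsevichZagierPeriods.HurwitzMicroSectors.DilationMoveNegative

open Summit.KontsevichZagierPeriods.KontsevichZagierPeriods.Theses.HurwitzMicroSectors (DilationMove)

/-! ## Kit in all dimensions: product-monomial representations on the unit box -/

/-- The product-monomial representation `[(0,1)ⁿ, x ↦ c·∏ᵢ xᵢ^k]` (`c ∈ ℚ`). [folklore] -/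
def prodRep (n : ℕ) (c : ℚ) (k : ℕ) : KZ.IntegralRep n where
  domain := {x | ∀ i, x i ∈ Ioo (0 : ℝ) 1}
  integrand := fun x => (c : ℝ) * ∏ i, x i ^ k
  isSemialgebraic_domain := by
    rw [← ibox_zero_one]
    exact isSemialgebraic_ibox n 0 1
  isSemialgebraicFunOn_integrand := by
    rw [← ibox_zero_one]
    exact (isSemialgebraicFunOn_aeval (isSemialgebraic_ibox n 0 1) (C c * ∏ i, X i ^ k)).congr
      (fun x _ => by simp [map_prod])
  integrableOn := by
    have hc : Continuous fun x : Fin n → ℝ => (c : ℝ) * ∏ i, x i ^ k := by fun_prop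
    refine (hc.continuousOn.integrableOn_compact
      (isCompact_Icc : IsCompact (Icc (0 : Fin n → ℝ) 1))).mono_set ?_
    intro x hx
    exact ⟨fun i => (hx i).1.le, fun i => (hx i).2.le⟩

/-- Auxiliary: `prodRep_domain`. [folklore] -/
@[simp] theorem prodRep_domain (n : ℕ) (c : ℚ) (k : ℕ) :
    (prodRep n c k).domain = {x | ∀ i, x i ∈ Ioo (0 : ℝ) 1} := rfl

/-- Auxiliary: `prodRep_integrand`. [folklore] -/
@[simp] theorem prodRep_integrand (n : ℕ) (c : ℚ) (k : ℕ) :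
    (prodRep n c k).integrand = fun x => (c : ℝ) * ∏ i, x i ^ k := rfl

/-- The unit box is the product set `univ.pi (fun _ => (0,1))`. [folklore] -/
theorem ubox_eq_pi (n : ℕ) :
    {x : Fin n → ℝ | ∀ i, x i ∈ Ioo (0 : ℝ) 1} = Set.univ.pi fun _ : Fin n => Ioo (0 : ℝ) 1 := by
  ext x
  simp

/-- `∫_(0,1) t^k dt = 1/(k+1)`. [folklore] -/
theorem setIntegral_pow_Ioo (k : ℕ) : ∫ t in Ioo (0 : ℝ) 1, t ^ k = 1 / ((k : ℝ) + 1) := by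
  rw [← integral_Ioc_eq_integral_Ioo, ← intervalIntegral.integral_of_le zero_le_one, integral_pow]
  simp

/-- **Value of the product-monomial rep** (Fubini on the box): `c / (k+1)ⁿ`. [folklore] -/
theorem value_prodRep (n : ℕ) (c : ℚ) (k : ℕ) :
    (prodRep n c k).value = c / ((k : ℝ) + 1) ^ n := by
  rw [KZ.IntegralRep.value, prodRep_domain, ubox_eq_pi, volume_pi, Measure.restrict_pi_pi]
  simp only [prodRep_integrand]
  rw [MeasureTheory.integral_const_mul, integral_fintype_prod_eq_pow (fun t : ℝ => t ^ k),
    setIntegral_pow_Ioo, Fintype.card_fin]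
  rw [one_div, inv_pow, div_eq_mul_inv]

/-! ## Tightness in all dimensions -/

/-- Master lemma for family 2 in dimension `n`: a pair of product-monomial witnesses with different
values kills `DilationMoveJac n m c₀ k₀`. [folklore] -/
theorem not_jacN_of_witness {n m : ℕ} {c₀ : ℚ} {k₀ : ℕ} (c : ℚ) (k : ℕ) (c' : ℚ) (k' : ℕ)
    (hrel : ∀ x : Fin n → ℝ, (∀ i, x i ∈ Ioo (0 : ℝ) 1) →
      (c : ℝ) * ∏ i, x i ^ k = (c' : ℝ) * (∏ i, (x i ^ m) ^ k') * ((c₀ : ℝ) * ∏ i, x i ^ k₀))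
    (hne : (prodRep n c k).value ≠ (prodRep n c' k').value) :
    ¬ DilationMoveJac n m c₀ k₀ := by
  intro h
  exact hne (value_eq_of_mem (h (prodRep n c k) (prodRep n c' k') rfl rfl fun x hx => hrel x hx))

/-- **Necessity in dimension `n ≥ 1`, for every `m : ℕ`.** If the move with factor `c·∏ xᵢ^k` is
valid then `c = (k+1)ⁿ` (test `r' = 1`) and `2(k+1) = m+k+1` (test `r' = ∏ xᵢ`, then injectivity
of `t ↦ tⁿ` on `(0,∞)`), i.e. `k + 1 = m` and `c = mⁿ`. In particular NO factor works at `m = 0`.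
[folklore] -/
theorem dilationMoveJac_necessary {n m : ℕ} (hn : 1 ≤ n) {c : ℚ} {k : ℕ}
    (h : DilationMoveJac n m c k) : c = (m : ℚ) ^ n ∧ k + 1 = m := by
  have hn0 : n ≠ 0 := by omega
  -- test 1: r' = 1, r = c·∏ xᵢ^k
  have h1 : (prodRep n c k).value = (prodRep n 1 0).value := by
    by_contra hne
    exact not_jacN_of_witness c k 1 0 (fun x _ => by simp) hne h
  rw [value_prodRep, value_prodRep] at h1
  have hk0 : ((k : ℝ) + 1) ^ n ≠ 0 := by positivity
  have hc : (c : ℝ) = ((k : ℝ) + 1) ^ n := by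
    rw [div_eq_iff hk0] at h1
    rw [h1]
    simp
  -- test 2: r' = ∏ xᵢ, r = c·∏ xᵢ^(m+k)
  have h2 : (prodRep n c (m + k)).value = (prodRep n 1 1).value := by
    by_contra hne
    refine not_jacN_of_witness c (m + k) 1 1 (fun x _ => ?_) hne h
    simp only [pow_add, Finset.prod_mul_distrib, pow_one, Rat.cast_one, one_mul]
    ring
  rw [value_prodRep, value_prodRep, hc] at h2
  push_cast at h2
  have hmk : (((m : ℝ) + k) + 1) ^ n ≠ 0 := by positivity
  have h3 : ((2 : ℝ) * ((k : ℝ) + 1)) ^ n = (((m : ℝ) + k) + 1) ^ n := by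
    rw [div_eq_div_iff hmk (by positivity)] at h2
    rw [mul_pow]
    linear_combination h2
  have h4 : (2 : ℝ) * ((k : ℝ) + 1) = ((m : ℝ) + k) + 1 :=
    (pow_left_inj₀ (by positivity) (by positivity) hn0).1 h3
  have hkm : k + 1 = m := by
    have : ((k + 1 : ℕ) : ℝ) = (m : ℝ) := by
      push_cast
      linarith
    exact_mod_cast this
  refine ⟨?_, hkm⟩
  have : (c : ℝ) = (((m : ℚ) ^ n : ℚ) : ℝ) := by
    rw [hc, ← hkm]
    push_cast
    ring
  exact_mod_cast this

/-- **TIGHTNESS IN ALL DIMENSIONS, relative to the crux.** Given the crux, for `n ≥ 1` and any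
`m : ℕ` the dilation move on `(0,1)ⁿ` with Jacobian factor `c·∏ᵢ xᵢ^k` (`c ∈ ℚ`, `k ∈ ℕ`) is valid
iff `c = mⁿ` and `k + 1 = m`: the crux's factor is the unique monomial one, and its constant depends
on the dimension. [folklore] -/
theorem dilationMoveJac_iff_of (hD : DilationMove) {n m : ℕ} (hn : 1 ≤ n) (c : ℚ) (k : ℕ) :
    DilationMoveJac n m c k ↔ c = (m : ℚ) ^ n ∧ k + 1 = m := by
  refine ⟨dilationMoveJac_necessary hn, ?_⟩
  rintro ⟨rfl, hkm⟩
  have hm : 1 ≤ m := by omega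
  have h := dilationMove_iff_jac.1 hD n m hm
  rwa [show m - 1 = k by omega] at h

/-- **`m = 0` is dead in every dimension `n ≥ 1`, for every factor** (no Jacobian repair rescues
the constant map; sharpens `dilationMove_false_without_oneLe`). [folklore] -/
theorem not_dilationMoveJac_zero_exp {n : ℕ} (hn : 1 ≤ n) (c : ℚ) (k : ℕ) :
    ¬ DilationMoveJac n 0 c k := fun h =>
  absurd (dilationMoveJac_necessary hn h).2 (by omega)

/-- **The one-dimensional constant does not survive in dimension 2**: `(n,m) = (2,2)` with factor
`2·xy` (instead of `4·xy`) is NOT a move — `r' = 1`, `r = 2xy` have values `1 ≠ 1/2`. This is the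
slip to avoid when `ReductionTwoSix` writes `H_r + H_(r+3) ∼ 4·H_(2r+1)` (the `4` is `2²`).
[folklore] -/
theorem not_dilationMoveJac_two_two_linear : ¬ DilationMoveJac 2 2 2 1 := fun h => by
  have := (dilationMoveJac_necessary (by norm_num) h).1
  norm_num at this

/-- **No constant at all fails for every `m ≥ 2`, `n ≥ 1`** (factor `∏ xᵢ^(m-1)` alone).
[folklore] -/
theorem not_dilationMoveJac_noConstant {n m : ℕ} (hn : 1 ≤ n) (hm : 2 ≤ m) :
    ¬ DilationMoveJac n m 1 (m - 1) := fun h => by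
  have h1 := (dilationMoveJac_necessary hn h).1
  have h2 : (1 : ℚ) < (m : ℚ) ^ n := one_lt_pow₀ (by exact_mod_cast hm) (by omega)
  exact absurd h1 (ne_of_lt h2)

/-- The consumer instance `(n,m) = (2,2)` (`ReductionTwoSix`, level 3 → 6; `CatalanSectorTwoFour`,
level 2 → 4): a valid monomial factor must be `4·xy`. [folklore] -/
theorem dilationMoveJac_two_two_necessary {c : ℚ} {k : ℕ} (h : DilationMoveJac 2 2 c k) :
    c = 4 ∧ k = 1 := by
  obtain ⟨h1, h2⟩ := dilationMoveJac_necessary (by norm_num) h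
  norm_num at h1
  exact ⟨h1, by omega⟩

/-- The consumer instance `(n,m) = (2,3)` (`ReductionTwoSix`, level 2 → 6): a valid monomial factor
must be `9·x²y²`. [folklore] -/
theorem dilationMoveJac_two_three_necessary {c : ℚ} {k : ℕ} (h : DilationMoveJac 2 3 c k) :
    c = 9 ∧ k = 2 := by
  obtain ⟨h1, h2⟩ := dilationMoveJac_necessary (by norm_num) h
  norm_num at h1
  exact ⟨h1, by omega⟩

/-- The consumer instance `(n,m) = (3,2)` (`AperySectorThreeTwo`, `H₀ + H₁ ∼ 8H₁`): a valid
monomial factor must be `8·xyz`. [folklore] -/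
theorem dilationMoveJac_three_two_necessary {c : ℚ} {k : ℕ} (h : DilationMoveJac 3 2 c k) :
    c = 8 ∧ k = 1 := by
  obtain ⟨h1, h2⟩ := dilationMoveJac_necessary (by norm_num) h
  norm_num at h1
  exact ⟨h1, by omega⟩

/-- **Degenerate dimension `n = 0`, necessity** (`Fin 0 → ℝ` is one point of volume 1, value =
integrand at the point): a valid factor has `c = 1`, whatever `m, k`. [folklore] -/
theorem dilationMoveJac_zero_necessary {m : ℕ} {c : ℚ} {k : ℕ} (h : DilationMoveJac 0 m c k) :
    c = 1 := by
  have h1 : (prodRep 0 c k).value = (prodRep 0 1 0).value := by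
    by_contra hne
    exact not_jacN_of_witness c k 1 0 (fun x _ => by simp) hne h
  rw [value_prodRep, value_prodRep] at h1
  norm_num at h1
  exact_mod_cast h1

/-- **Degenerate dimension `n = 0`, relative to the crux**: the move with factor `c` holds iff
`c = 1`, whatever `m, k` (`x ↦ x^m` is the identity of the one-point space) — so `1 ≤ n` in
`dilationMoveJac_iff_of` is needed, and at `n = 0` even `m = 0` is harmless. [folklore] -/
theorem dilationMoveJac_zero_iff_of (hD : DilationMove) (m : ℕ) (c : ℚ) (k : ℕ) :
    DilationMoveJac 0 m c k ↔ c = 1 := by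
  refine ⟨dilationMoveJac_zero_necessary, ?_⟩
  rintro rfl
  intro r r' hr hr' hrel
  refine dilationMove_iff_jac.1 hD 0 1 le_rfl r r' hr hr' fun x hx => ?_
  rw [hrel x hx]
  have hx' : (fun i => x i ^ m) = fun i => x i ^ 1 := funext fun i => Fin.elim0 i
  simp [hx']

end Summit.KontsevichZagierPeriods.HurwitzMicroSectors.DilationMoveNegative

end
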